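import Mathlib
import Summits.Ventures.PercRepro2.K5K3Transfer
import Summits.Ventures.PercRepro2.K5Hyper

/-!
# ONE UNMARKED STAR VERTEX OVER AN ALL-MARKED BASE, I: CONNECTIVITY THROUGH THE STAR VERTEX
(blind cell PercRepro2, p2 g2, 2026-08-25; sub-claim S1 (C) of ASSIGNMENTS v12.61 — the degree-3
class as a `K₅` + hyperedge chain on typer-1's `orOn` masks; mine-1's MINE1-J1.md §23.8 / §23.12 /
§24 read in the kernel)

Setting.  `m : V → Fin 5` is injective on a set `M` of marks; `F₀` is an ALL-MARKED typed set (every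
end in `M`), loop-free; `e_i = u–v_i` are the three typed edges of an UNMARKED vertex `u ∉ M` to marks
`v_i ∈ M`; every edge off `F₀ ∪ {e₁, e₂, e₃}` is pinned closed.

In a copy in which exactly the star edges with `s_i = true` are open (`starUpd e₁ e₂ e₃ s₁ s₂ s₃ x`,
`x` closed off `F₀`), `u` merges the marks `{v_i : s_i = true}`: for marks `p, q` the connection
`p ↔ q` holds iff it holds in `K₅` at the pattern of `x` with the CLIQUE on `{m v_i : s_i = true}`
forced open — typer-1's `orOn` mask `starMask (m v₁) (m v₂) (m v₃) s₁ s₂ s₃`: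
**`conn_iff_star`**.  `StarData` packages the star's side conditions.  Part II (TypedStarK5.lean)
transports the kernel `K₃` and the typed counts.

Own code; standard axioms.
-/

namespace Summit.Ventures.PercRepro2

open Hub

namespace K5

/-! ## The star mask -/

section Mask

/-- The clique mask of the marks `p_i` with `s_i = true`: the pairs of `K₅` joined through the star
vertex when exactly the star edges with `s_i = true` are open. -/
def starMask (p₁ p₂ p₃ : Fin 5) (s₁ s₂ s₃ : Bool) : Fin 10 → Bool := fun j =>
  (s₁ && s₂ && pairMask p₁ p₂ j) || (s₁ && s₃ && pairMask p₁ p₃ j) || (s₂ && s₃ && pairMask p₂ p₃ j)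

/-- `pairMask x y j` holds iff the pair `j` of `K₅` is `{x, y}`. -/
lemma pairMask_eq_true_iff (x y : Fin 5) (j : Fin 10) : pairMask x y j = true ↔ ends5 j = s(x, y) := by
  unfold pairMask
  rw [decide_eq_true_iff, ends5_eq_iff]
  constructor
  · rintro (⟨h1, h2⟩ | ⟨h1, h2⟩)
    · exact Or.inl ⟨h1, h2⟩
    · exact Or.inr ⟨h2, h1⟩
  · rintro (⟨h1, h2⟩ | ⟨h1, h2⟩)
    · exact Or.inl ⟨h1, h2⟩
    · exact Or.inr ⟨h2, h1⟩

/-- A pair of two open star neighbours is in the star mask. -/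
lemma starMask_of_pair {p₁ p₂ p₃ : Fin 5} {s₁ s₂ s₃ : Bool} {j : Fin 10} {x y : Fin 5}
    (hj : ends5 j = s(x, y))
    (h : (s₁ = true ∧ s₂ = true ∧ s(x, y) = s(p₁, p₂)) ∨ (s₁ = true ∧ s₃ = true ∧ s(x, y) = s(p₁, p₃)) ∨
      (s₂ = true ∧ s₃ = true ∧ s(x, y) = s(p₂, p₃))) :
    starMask p₁ p₂ p₃ s₁ s₂ s₃ j = true := by
  unfold starMask
  rcases h with ⟨h1, h2, h3⟩ | ⟨h1, h2, h3⟩ | ⟨h1, h2, h3⟩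
  · have : pairMask p₁ p₂ j = true := (pairMask_eq_true_iff _ _ _).2 (hj.trans h3)
    simp [h1, h2, this]
  · have : pairMask p₁ p₃ j = true := (pairMask_eq_true_iff _ _ _).2 (hj.trans h3)
    simp [h1, h2, this]
  · have : pairMask p₂ p₃ j = true := (pairMask_eq_true_iff _ _ _).2 (hj.trans h3)
    simp [h1, h2, this]

/-- What a pair in the star mask is. -/
lemma starMask_eq_true_iff (p₁ p₂ p₃ : Fin 5) (s₁ s₂ s₃ : Bool) (j : Fin 10) :
    starMask p₁ p₂ p₃ s₁ s₂ s₃ j = true ↔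
      (s₁ = true ∧ s₂ = true ∧ ends5 j = s(p₁, p₂)) ∨ (s₁ = true ∧ s₃ = true ∧ ends5 j = s(p₁, p₃)) ∨
        (s₂ = true ∧ s₃ = true ∧ ends5 j = s(p₂, p₃)) := by
  unfold starMask
  simp only [Bool.or_eq_true, Bool.and_eq_true, pairMask_eq_true_iff]
  tauto

/-- The pattern is below the masked pattern. -/
lemma le_orOn (S ω : Fin 10 → Bool) : ω ≤ orOn S ω := by
  intro j
  rw [Bool.le_iff_imp]
  intro h
  simp [orOn, h]

end Mask

/-! ## The star update of a configuration -/

section Upd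

variable {E : Type*} [DecidableEq E]

/-- The configuration with the three star edges set to `s₁, s₂, s₃` (the form produced by
`typedCount_split3`). -/
def starUpd (e₁ e₂ e₃ : E) (s₁ s₂ s₃ : Bool) (x : Config E) : Config E :=
  Function.update (Function.update (Function.update x e₃ s₃) e₂ s₂) e₁ s₁

variable {e₁ e₂ e₃ : E} (h12 : e₁ ≠ e₂) (h13 : e₁ ≠ e₃) (h23 : e₂ ≠ e₃) (s₁ s₂ s₃ : Bool)
  (x : Config E)

include h12 h13 h23 in
/-- The star update at the star edges. -/
lemma starUpd_apply :
    starUpd e₁ e₂ e₃ s₁ s₂ s₃ x e₁ = s₁ ∧ starUpd e₁ e₂ e₃ s₁ s₂ s₃ x e₂ = s₂ ∧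
      starUpd e₁ e₂ e₃ s₁ s₂ s₃ x e₃ = s₃ := by
  unfold starUpd
  refine ⟨by simp, ?_, ?_⟩
  · rw [Function.update_of_ne h12.symm, Function.update_self]
  · rw [Function.update_of_ne h13.symm, Function.update_of_ne h23.symm, Function.update_self]

/-- The star update off the star edges. -/
lemma starUpd_of_ne {e : E} (he1 : e ≠ e₁) (he2 : e ≠ e₂) (he3 : e ≠ e₃) :
    starUpd e₁ e₂ e₃ s₁ s₂ s₃ x e = x e := by
  unfold starUpd
  rw [Function.update_of_ne he1, Function.update_of_ne he2, Function.update_of_ne he3]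

end Upd

/-! ## Connectivity through the star vertex -/

section Conn

variable {V : Type*} {E : Type*} [Fintype E] [DecidableEq E] [DecidableEq V]
variable (m : V → Fin 5) (ends : E → Sym2 V) (F₀ : Finset E) {M : Set V}

omit [Fintype E] [DecidableEq E] [DecidableEq V] in
/-- A star edge is not in the all-marked part. -/
lemma star_not_mem (hM : ∀ e ∈ F₀, ∀ v ∈ ends e, v ∈ M) {u v : V} {e : E} (hu : u ∉ M)
    (he : ends e = s(u, v)) : e ∉ F₀ :=
  fun heF => hu (hM e heF u (by rw [he]; exact Sym2.mem_mk_left u v))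

omit [Fintype E] [DecidableEq V] in
/-- In the star update the mark `v_i` with `s_i = true` is joined to `u`. -/
lemma conn_starUpd_of_open {u v : V} {e₁ e₂ e₃ : E} {s₁ s₂ s₃ : Bool} (x : Config E) {e : E}
    (he : ends e = s(u, v)) (hs : starUpd e₁ e₂ e₃ s₁ s₂ s₃ x e = true) :
    Conn ends (starUpd e₁ e₂ e₃ s₁ s₂ s₃ x) u v :=
  conn_of_openAdj ⟨e, hs, he⟩

omit [Fintype E] [DecidableEq V] in
/-- **Connections of the star update transfer to the masked pattern.** -/
lemma conn_masked_of_conn_starUpd (hinj : Set.InjOn m M) (hM : ∀ e ∈ F₀, ∀ v ∈ ends e, v ∈ M)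
    (hloop : ∀ e ∈ F₀, ¬ (ends e).IsDiag) {u v₁ v₂ v₃ : V} {e₁ e₂ e₃ : E} (hu : u ∉ M)
    (hv₁ : v₁ ∈ M) (hv₂ : v₂ ∈ M) (hv₃ : v₃ ∈ M) (h1 : ends e₁ = s(u, v₁)) (h2 : ends e₂ = s(u, v₂))
    (h3 : ends e₃ = s(u, v₃)) (h12 : e₁ ≠ e₂) (h13 : e₁ ≠ e₃) (h23 : e₂ ≠ e₃) {x : Config E}
    (hx : ClosedOff F₀ x) (s₁ s₂ s₃ : Bool) {p q : V} (hp : p ∈ M) (hq : q ∈ M)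
    (h : Conn ends (starUpd e₁ e₂ e₃ s₁ s₂ s₃ x) p q) :
    Conn ends5 (orOn (starMask (m v₁) (m v₂) (m v₃) s₁ s₂ s₃) (patternM m ends F₀ x)) (m p) (m q) := by
  set σ := orOn (starMask (m v₁) (m v₂) (m v₃) s₁ s₂ s₃) (patternM m ends F₀ x) with hσ
  set x' := starUpd e₁ e₂ e₃ s₁ s₂ s₃ x with hx'
  obtain ⟨hx1, hx2, hx3⟩ := starUpd_apply h12 h13 h23 s₁ s₂ s₃ x
  -- two open star neighbours are joined in `K₅` through the mask
  have hpair : ∀ {a b : V} {sa sb : Bool}, a ∈ M → b ∈ M →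
      ((sa = s₁ ∧ a = v₁) ∨ (sa = s₂ ∧ a = v₂) ∨ (sa = s₃ ∧ a = v₃)) →
      ((sb = s₁ ∧ b = v₁) ∨ (sb = s₂ ∧ b = v₂) ∨ (sb = s₃ ∧ b = v₃)) → sa = true → sb = true →
      a ≠ b → Conn ends5 σ (m a) (m b) := by
    intro a b sa sb ha hb hA hB hsa hsb hab
    have hmab : m a ≠ m b := fun h => hab (hinj ha hb h)
    obtain ⟨j, hj⟩ := exists_edge5 (m a) (m b) hmab
    refine conn_of_openAdj ⟨j, ?_, hj⟩
    rw [hσ]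
    unfold orOn
    rw [Bool.or_eq_true]
    right
    refine starMask_of_pair hj ?_
    rcases hA with ⟨rfl, rfl⟩ | ⟨rfl, rfl⟩ | ⟨rfl, rfl⟩ <;>
      rcases hB with ⟨rfl, rfl⟩ | ⟨rfl, rfl⟩ | ⟨rfl, rfl⟩
    · exact absurd rfl hab
    · exact Or.inl ⟨hsa, hsb, rfl⟩
    · exact Or.inr (Or.inl ⟨hsa, hsb, rfl⟩)
    · exact Or.inl ⟨hsb, hsa, Sym2.eq_swap⟩
    · exact absurd rfl hab
    · exact Or.inr (Or.inr ⟨hsa, hsb, rfl⟩)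
    · exact Or.inr (Or.inl ⟨hsb, hsa, Sym2.eq_swap⟩)
    · exact Or.inr (Or.inr ⟨hsb, hsa, Sym2.eq_swap⟩)
    · exact absurd rfl hab
  -- the closed set: marks joined to `m p` in `K₅`, and `u` when an open star neighbour is
  let S : Set V := {y | (y ∈ M ∧ Conn ends5 σ (m p) (m y)) ∨
    (y = u ∧ ((s₁ = true ∧ Conn ends5 σ (m p) (m v₁)) ∨ (s₂ = true ∧ Conn ends5 σ (m p) (m v₂)) ∨
      (s₃ = true ∧ Conn ends5 σ (m p) (m v₃))))}
  -- a step from a star neighbour `a` to `u` and from `u` to a star neighbour `b`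
  have hstep_to_u : ∀ {a : V} {sa : Bool}, a ∈ M →
      ((sa = s₁ ∧ a = v₁) ∨ (sa = s₂ ∧ a = v₂) ∨ (sa = s₃ ∧ a = v₃)) → sa = true →
      Conn ends5 σ (m p) (m a) → u ∈ S := by
    intro a sa ha hA hsa hc
    right
    refine ⟨rfl, ?_⟩
    rcases hA with ⟨rfl, rfl⟩ | ⟨rfl, rfl⟩ | ⟨rfl, rfl⟩
    · exact Or.inl ⟨hsa, hc⟩
    · exact Or.inr (Or.inl ⟨hsa, hc⟩)
    · exact Or.inr (Or.inr ⟨hsa, hc⟩)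
  have hstep_from_u : ∀ {b : V} {sb : Bool}, b ∈ M →
      ((sb = s₁ ∧ b = v₁) ∨ (sb = s₂ ∧ b = v₂) ∨ (sb = s₃ ∧ b = v₃)) → sb = true → u ∈ S → b ∈ S := by
    intro b sb hb hB hsb huS
    left
    refine ⟨hb, ?_⟩
    rcases huS with ⟨huM, -⟩ | ⟨-, hcase⟩
    · exact absurd huM hu
    have key : ∀ {a : V} {sa : Bool}, a ∈ M →
        ((sa = s₁ ∧ a = v₁) ∨ (sa = s₂ ∧ a = v₂) ∨ (sa = s₃ ∧ a = v₃)) → sa = true →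
        Conn ends5 σ (m p) (m a) → Conn ends5 σ (m p) (m b) := by
      intro a sa ha hA hsa hc
      by_cases hab : a = b
      · rw [← hab]; exact hc
      · exact conn_trans hc (hpair ha hb hA hB hsa hsb hab)
    rcases hcase with ⟨hs, hc⟩ | ⟨hs, hc⟩ | ⟨hs, hc⟩
    · exact key hv₁ (Or.inl ⟨rfl, rfl⟩) hs hc
    · exact key hv₂ (Or.inr (Or.inl ⟨rfl, rfl⟩)) hs hc
    · exact key hv₃ (Or.inr (Or.inr ⟨rfl, rfl⟩)) hs hc
  -- closure of `S` under open adjacency in `x'`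
  have hS : ∀ y ∈ S, ∀ y', (openGraph ends x').Adj y y' → y' ∈ S := by
    intro y hy y' hadj
    obtain ⟨hne, e, he, hends⟩ := openGraph_adj.1 hadj
    -- a step along a star edge
    have hstar : ∀ {i : E} {vi : V} {si : Bool}, ends i = s(u, vi) → vi ∈ M → x' i = si →
        ((si = s₁ ∧ vi = v₁) ∨ (si = s₂ ∧ vi = v₂) ∨ (si = s₃ ∧ vi = v₃)) → e = i → y' ∈ S := by
      intro i vi si hi hvi hxi hI hei
      subst hei
      rw [hxi] at he
      rw [hi] at hends
      rcases Sym2.eq_iff.1 hends with ⟨rfl, rfl⟩ | ⟨rfl, rfl⟩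
      · -- `y = u`, `y' = vi`
        exact hstep_from_u hvi hI he hy
      · -- `y = vi`, `y' = u`
        rcases hy with ⟨-, hc⟩ | ⟨hyu, -⟩
        · exact hstep_to_u hvi hI he hc
        · exact absurd hyu hne
    by_cases he1 : e = e₁
    · exact hstar h1 hv₁ hx1 (Or.inl ⟨rfl, rfl⟩) he1
    by_cases he2 : e = e₂
    · exact hstar h2 hv₂ hx2 (Or.inr (Or.inl ⟨rfl, rfl⟩)) he2
    by_cases he3 : e = e₃
    · exact hstar h3 hv₃ hx3 (Or.inr (Or.inr ⟨rfl, rfl⟩)) he3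
    -- an edge of the all-marked part
    have hxe : x e = true := by rw [← starUpd_of_ne s₁ s₂ s₃ x he1 he2 he3]; exact he
    have heF : e ∈ F₀ := by
      by_contra hF
      rw [hx e hF] at hxe
      exact Bool.false_ne_true hxe
    have hyM : y ∈ M := hM e heF y (by rw [hends]; exact Sym2.mem_mk_left y y')
    have hy'M : y' ∈ M := hM e heF y' (by rw [hends]; exact Sym2.mem_mk_right y y')
    rcases hy with ⟨-, hc⟩ | ⟨hyu, -⟩
    · left
      refine ⟨hy'M, conn_trans hc (conn_mono (le_orOn _ _) (conn_of_openAdj ?_))⟩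
      exact openAdj_patternM m ends F₀ hinj hM hloop hx ⟨e, hxe, hends⟩
    · exact absurd (hyu ▸ hyM) hu
  have hqS : q ∈ S := mem_of_conn_of_closed hS (Or.inl ⟨hp, conn_refl _ _ _⟩) h
  rcases hqS with ⟨-, hc⟩ | ⟨hqu, -⟩
  · exact hc
  · exact absurd (hqu ▸ hq) hu

omit [Fintype E] [DecidableEq V] in
/-- **Connections of the masked pattern lift to the star update.** -/
lemma conn_starUpd_of_conn_masked (hinj : Set.InjOn m M) (hM : ∀ e ∈ F₀, ∀ v ∈ ends e, v ∈ M)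
    {u v₁ v₂ v₃ : V} {e₁ e₂ e₃ : E} (hu : u ∉ M)
    (hv₁ : v₁ ∈ M) (hv₂ : v₂ ∈ M) (hv₃ : v₃ ∈ M) (h1 : ends e₁ = s(u, v₁)) (h2 : ends e₂ = s(u, v₂))
    (h3 : ends e₃ = s(u, v₃)) (h12 : e₁ ≠ e₂) (h13 : e₁ ≠ e₃) (h23 : e₂ ≠ e₃) (x : Config E)
    (s₁ s₂ s₃ : Bool) {p q : V} (hp : p ∈ M) (hq : q ∈ M)
    (h : Conn ends5 (orOn (starMask (m v₁) (m v₂) (m v₃) s₁ s₂ s₃) (patternM m ends F₀ x))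
      (m p) (m q)) :
    Conn ends (starUpd e₁ e₂ e₃ s₁ s₂ s₃ x) p q := by
  set σ := orOn (starMask (m v₁) (m v₂) (m v₃) s₁ s₂ s₃) (patternM m ends F₀ x) with hσ
  set x' := starUpd e₁ e₂ e₃ s₁ s₂ s₃ x with hx'
  obtain ⟨hx1, hx2, hx3⟩ := starUpd_apply h12 h13 h23 s₁ s₂ s₃ x
  have he1F : e₁ ∉ F₀ := star_not_mem ends F₀ hM hu h1
  have he2F : e₂ ∉ F₀ := star_not_mem ends F₀ hM hu h2
  have he3F : e₃ ∉ F₀ := star_not_mem ends F₀ hM hu h3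
  -- open star neighbours are joined in `x'` through `u`
  have hjoin : ∀ {a b : V} {sa sb : Bool} {ea eb : E}, ends ea = s(u, a) → ends eb = s(u, b) →
      x' ea = sa → x' eb = sb → sa = true → sb = true → Conn ends x' a b := by
    intro a b sa sb ea eb hea heb hxa hxb hsa hsb
    rw [hsa] at hxa
    rw [hsb] at hxb
    exact conn_trans (conn_symm (conn_of_openAdj ⟨ea, hxa, hea⟩)) (conn_of_openAdj ⟨eb, hxb, heb⟩)
  let S : Set (Fin 5) := {r | ∃ y ∈ M, m y = r ∧ Conn ends x' p y}
  have hS : ∀ r ∈ S, ∀ r', (openGraph ends5 σ).Adj r r' → r' ∈ S := by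
    intro r hr r' hadj
    obtain ⟨y, hy, hmy, hpy⟩ := hr
    obtain ⟨hne, j, hj, hends⟩ := openGraph_adj.1 hadj
    rw [hσ] at hj
    unfold orOn at hj
    rw [Bool.or_eq_true] at hj
    rcases hj with hj | hj
    · -- an open pair of the pattern: an open edge of `F₀`
      unfold patternM at hj
      rw [decide_eq_true_iff] at hj
      obtain ⟨e, he, hxe⟩ := hj
      obtain ⟨heF, hmap⟩ := (mem_bundleM m ends F₀).1 he
      obtain ⟨x₁, y₁, hx₁, hy₁, hxy⟩ := ends_eq_of_mem ends F₀ hM heF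
      have hx'e : x' e = true := by
        rw [hx', starUpd_of_ne s₁ s₂ s₃ x (fun h => he1F (by rw [← h]; exact heF))
          (fun h => he2F (by rw [← h]; exact heF)) (fun h => he3F (by rw [← h]; exact heF))]
        exact hxe
      rw [hxy, Sym2.map_mk, hends, Sym2.eq_iff] at hmap
      rcases hmap with ⟨hm1, hm2⟩ | ⟨hm1, hm2⟩
      · have hxx : x₁ = y := hinj hx₁ hy (hm1.trans hmy.symm)
        refine ⟨y₁, hy₁, hm2, conn_trans hpy (conn_of_openAdj ⟨e, hx'e, ?_⟩)⟩
        rw [hxy, hxx]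
      · have hyx : y₁ = y := hinj hy₁ hy (hm2.trans hmy.symm)
        refine ⟨x₁, hx₁, hm1, conn_trans hpy (conn_of_openAdj ⟨e, hx'e, ?_⟩)⟩
        rw [hxy, hyx, Sym2.eq_swap]
    · -- a pair of the star mask: two open star neighbours
      rw [starMask_eq_true_iff] at hj
      -- a generic case: the pair `{m a, m b}` with `a, b` open star neighbours
      have hcase : ∀ {a b : V} {sa sb : Bool} {ea eb : E}, a ∈ M → b ∈ M → ends ea = s(u, a) →
          ends eb = s(u, b) → x' ea = sa → x' eb = sb → sa = true → sb = true →
          ends5 j = s(m a, m b) → r' ∈ S := by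
        intro a b sa sb ea eb ha hb hea heb hxa hxb hsa hsb hjab
        have hab : Conn ends x' a b := hjoin hea heb hxa hxb hsa hsb
        rw [hends, Sym2.eq_iff] at hjab
        rcases hjab with ⟨hra, hrb⟩ | ⟨hrb, hra⟩
        · have hya : y = a := hinj hy ha (hmy.trans hra)
          exact ⟨b, hb, hrb.symm, conn_trans hpy (hya ▸ hab)⟩
        · have hyb : y = b := hinj hy hb (hmy.trans hrb)
          exact ⟨a, ha, hra.symm, conn_trans hpy (hyb ▸ conn_symm hab)⟩
      rcases hj with ⟨hs1, hs2, hj⟩ | ⟨hs1, hs3, hj⟩ | ⟨hs2, hs3, hj⟩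
      · exact hcase hv₁ hv₂ h1 h2 hx1 hx2 hs1 hs2 hj
      · exact hcase hv₁ hv₃ h1 h3 hx1 hx3 hs1 hs3 hj
      · exact hcase hv₂ hv₃ h2 h3 hx2 hx3 hs2 hs3 hj
  obtain ⟨y, hy, hmy, hpy⟩ := mem_of_conn_of_closed hS ⟨p, hp, rfl, conn_refl _ _ _⟩ h
  rwa [hinj hy hq hmy] at hpy

omit [Fintype E] [DecidableEq V] in
/-- **`Conn ends x' p q ↔ Conn ends5 (orOn (starMask …) (patternM x)) (m p) (m q)`** for marks `p, q`,
`x` closed off the all-marked part and `x'` its star update. -/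
theorem conn_iff_star (hinj : Set.InjOn m M) (hM : ∀ e ∈ F₀, ∀ v ∈ ends e, v ∈ M)
    (hloop : ∀ e ∈ F₀, ¬ (ends e).IsDiag) {u v₁ v₂ v₃ : V} {e₁ e₂ e₃ : E} (hu : u ∉ M)
    (hv₁ : v₁ ∈ M) (hv₂ : v₂ ∈ M) (hv₃ : v₃ ∈ M) (h1 : ends e₁ = s(u, v₁)) (h2 : ends e₂ = s(u, v₂))
    (h3 : ends e₃ = s(u, v₃)) (h12 : e₁ ≠ e₂) (h13 : e₁ ≠ e₃) (h23 : e₂ ≠ e₃) {x : Config E}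
    (hx : ClosedOff F₀ x) (s₁ s₂ s₃ : Bool) {p q : V} (hp : p ∈ M) (hq : q ∈ M) :
    Conn ends (starUpd e₁ e₂ e₃ s₁ s₂ s₃ x) p q ↔
      Conn ends5 (orOn (starMask (m v₁) (m v₂) (m v₃) s₁ s₂ s₃) (patternM m ends F₀ x)) (m p) (m q) :=
  ⟨conn_masked_of_conn_starUpd m ends F₀ hinj hM hloop hu hv₁ hv₂ hv₃ h1 h2 h3 h12 h13 h23 hx s₁ s₂ s₃
      hp hq,
    conn_starUpd_of_conn_masked m ends F₀ hinj hM hu hv₁ hv₂ hv₃ h1 h2 h3 h12 h13 h23 x s₁ s₂ s₃ hp hq⟩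

/-- The data of one star: the vertex `u`, its neighbours and edges, with the side conditions. -/
structure StarData (M : Set V) (u v₁ v₂ v₃ : V) (e₁ e₂ e₃ : E) : Prop where
  hu : u ∉ M
  hv₁ : v₁ ∈ M
  hv₂ : v₂ ∈ M
  hv₃ : v₃ ∈ M
  h1 : ends e₁ = s(u, v₁)
  h2 : ends e₂ = s(u, v₂)
  h3 : ends e₃ = s(u, v₃)
  h12 : e₁ ≠ e₂
  h13 : e₁ ≠ e₃
  h23 : e₂ ≠ e₃

end Conn

end K5

end Summit.Ventures.PercRepro2
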